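import Literature.NumberTheory.Automorphic.GLnLeviQuotientIwasawaIntegration
import Literature.NumberTheory.Automorphic.ParabolicSemidirect
import Literature.NumberTheory.Automorphic.CompactOpenIdempotentConvolution
import Literature.NumberTheory.Automorphic.CongruenceSubgroupExpansionGL
import Literature.NumberTheory.Automorphic.UnipotentRadicalCompactOpenProofs
import HarnessLib

/-!
# The constant term `φ ↦ φ^{(P)}`, `φ^{(P)}(m) = ∫_{K × U_c} φ(k (m u) k⁻¹) d(κ ⊗ μ_U)`, along a standard
# parabolic `P_c = M_c U_c` of `GL_n(F)` preserves `C_c^∞`: `φ^{(P)}|_{M_c}` is locally constant with compact support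

Topic `NumberTheory/Automorphic`; namespace `Literature.NumberTheory.Automorphic`. KERNEL mathematics only:
theorems, no definition, no named fact, no instance, no notation, no `sorry`. Cell `pub/hodgecm-mathlib`,
programme P3a, road «D-N6s» (letter N6 = ★ `Rogawski1990/LocalTransferUnitExplicitFactor.LocalTransferExplicit`,
the local endoscopic transfer `φ ↦ φ^H` of [Rogawski1990, Prop. 4.9.1 (a)], AT A PLACE SPLIT IN `L`): there
`G′_v ≅ GL₃(L_w)`, `H_v ≅ GL₂(L_w) × GL₁(L_w)` is the Levi `M` of a parabolic `P = M U`, and the transfer of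
`φ ∈ C_c^∞(G′_v)` is — up to a locally constant multiplier `τ_v · δ_P^{1/2}` and a constant — its CONSTANT TERM
`φ^{(P)}` restricted to `M` (Rogawski (1990), Lemma 4.13.1 (a) p. 64 and its proof pp. 64–66:
`Φ^G(γ, f) = |D_{G/M}(γ)|^{-1/2} Φ^M(γ, f̄^P)`, `f̄^P(m) = δ_P(m)^{1/2} ∫_K ∫_N f(k⁻¹ m n k) dn dk`; the orbital side
is ★ `GLnLeviOrbitalDescent.exists_lintegral_descConj_eq_mul_lintegral_levi`, whose `M`-side integrand is EXACTLY the
inline lambda below in `lintegral` form). This file is the test-function half: **the constant term of a locally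
constant compactly supported `φ` is locally constant on `GL_n(F)` and compactly supported on `M_c`** — the first
step of «`f ↦ f̄^P : C_c^∞(G) → C_c^∞(M)`» (Harish-Chandra – van Dijk; Cartier §IV; Bernstein–Zelevinsky §2.3).

Setting: `F` a non-archimedean local field, `c : Fin n → α` ANY block labelling, `P_c ⊇ M_c, U_c` (★ `ParabolicGL`),
`K = GL_n(𝒪)` (★ `glInt`); the measure `ρ` on `K × U_c` is ARBITRARY where the statement allows (compact support and
local constancy do not depend on it). The constant term is the INLINE lambda
`m ↦ ∫ q, φ (↑q.1 * (m * ↑q.2) * (↑q.1)⁻¹) ∂ρ`, `q : ↥(glInt n F) × ↥(unipotentRadicalGL F c)` (Bochner twin of the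
lambda of ★ `exists_lintegral_descConj_eq_mul_lintegral_levi`), so consumers instantiate by `rfl`.

* §1 (generic group) `exists_open_nhds_one_forall_conj_mem` — conjugation by a COMPACT set is uniformly continuous
  at `1` (generalized tube lemma); `isLocallyConstant_of_forall_nhds_one_mul`; `integral_conj_mul_left_eq_of_forall`.
* §2.1 `continuous_constantTermIntegrand`, `hasCompactSupport_constantTermIntegrand`, `integrable_constantTermIntegrand`
  — the `K × U_c` integrand at a fixed `m` is continuous with compact support, hence integrable for `κ`, `μ_U` finite
  on compacta.
* §2.2 **`isLocallyConstant_constantTerm_of_forall_mul_left`** — for `φ` invariant under left translation by a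
  neighbourhood of `1`, `m ↦ φ^{(P)}(m)` is locally constant on ALL of `GL_n(F)` (`k m₀ k⁻¹ ∈ K₀` for `m₀` near `1`,
  uniformly in `k ∈ K`); **`isLocallyConstant_constantTerm`** — the same for `φ` locally constant with compact
  support (★ `exists_isOpen_isCompact_forall_mul_eq_of_isLocallyConstant`, ★ `nonarchimedeanGroup_gl`).
* §2.3 `isLocallyConstant_constantTerm_levi`; **`hasCompactSupport_constantTerm_levi`** — for `φ` compactly
  supported, `φ^{(P)}|_{M_c}` has compact support (inside the block-diagonal parts of `P_c ∩ K⁻¹ (tsupport φ) K`,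
  ★ `leviProjection`, ★ `continuous_leviProjection`, ★ `isClosed_standardParabolicGL`);
  `isLocallyConstant_and_hasCompactSupport_mul_constantTerm_levi` — with a locally constant multiplier
  `ψ : M_c → ℂ` (the slot for `τ_v · δ_P^{1/2}`).
* §2.4 the same on the block coordinates `Π_a GL_{n_a}(F)` (`isClosedEmbedding_blockDiagonalGL_codRestrict`,
  `hasCompactSupport_constantTerm_blockDiagonalGL`, `isLocallyConstant_constantTerm_blockDiagonalGL`).
NOT here (road «D-N6s» bricks B2–B5 ∕ A-p13's «D-N7s»): the unit instance `(1_K)^{(P)} = vol · 1_{K_M}`, the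
descent identity, transfer factors, unitary groups.

## References
* [Rogawski1990] J. D. Rogawski, *Automorphic Representations of Unitary Groups in Three Variables*, Ann. of
  Math. Stud. 123 (1990), §4.13 («The case of split primes»), Lemma 4.13.1 (a) p. 64 and its proof pp. 64–66; §4.9 p. 55.
* [BernsteinZelevinsky1977] I. N. Bernstein, A. V. Zelevinsky, *Induced representations of reductive `p`-adic
  groups I*, Ann. Sci. ÉNS 10 (1977), §2.3 (the functor `r_{M,G}` on `C_c^∞`).
* [CartierCorvallis1979] P. Cartier, *Representations of `p`-adic groups: a survey*, PSPM 33.1 (1979), §IV.1–IV.2.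
-/


set_option autoImplicit false

noncomputable section

open MeasureTheory Measure Set Filter Topology
open scoped MatrixGroups

namespace Literature.NumberTheory.Automorphic

open Literature.NumberTheory.GaloisRepresentations.IsNonarchimedeanLocalField

/-! ## §1 Generic topological groups -/

section Generic

variable {G : Type*} [Group G] [TopologicalSpace G] [IsTopologicalGroup G]

/-- **Conjugation by a compact set is uniformly continuous at `1`**: for `C ⊆ G` compact and an open `W ∋ 1`
there is an open `V ∋ 1` with `k m k⁻¹ ∈ W` for all `k ∈ C`, `m ∈ V` (generalized tube lemma for
`(k, m) ↦ k m k⁻¹` at `C × {1}`). [cite: CartierCorvallis1979, §IV.1] -/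
theorem exists_open_nhds_one_forall_conj_mem {C : Set G} (hC : IsCompact C) {W : Set G}
    (hW : IsOpen W) (h1 : (1 : G) ∈ W) :
    ∃ V : Set G, IsOpen V ∧ (1 : G) ∈ V ∧ ∀ k ∈ C, ∀ m ∈ V, k * m * k⁻¹ ∈ W := by
  have hcont : Continuous fun p : G × G => p.1 * p.2 * p.1⁻¹ :=
    (continuous_fst.mul continuous_snd).mul continuous_fst.inv
  have hsub : C ×ˢ ({1} : Set G) ⊆ (fun p : G × G => p.1 * p.2 * p.1⁻¹) ⁻¹' W := by
    rintro ⟨k, m⟩ ⟨-, hm⟩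
    rw [Set.mem_singleton_iff] at hm
    subst hm
    simpa only [Set.mem_preimage, mul_one, mul_inv_cancel] using h1
  obtain ⟨u, v, -, hv, hCu, h1v, huv⟩ :=
    generalized_tube_lemma hC isCompact_singleton (hW.preimage hcont) hsub
  refine ⟨v, hv, Set.singleton_subset_iff.1 h1v, fun k hk m hm => ?_⟩
  exact huv (Set.mk_mem_prod (hCu hk) hm)

/-- **A function invariant under left multiplication by a neighbourhood of `1` is locally constant**:
if `Φ (m₀ m) = Φ m` for all `m₀ ∈ V ∈ 𝓝 1` and all `m`, then `Φ` is constant on the open neighbourhood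
`{m′ | m′ m⁻¹ ∈ V°}` of every `m`. [cite: CartierCorvallis1979, §IV.1] -/
theorem isLocallyConstant_of_forall_nhds_one_mul {Y : Type*} {Φ : G → Y} {V : Set G}
    (hV : V ∈ 𝓝 (1 : G)) (h : ∀ m₀ ∈ V, ∀ m, Φ (m₀ * m) = Φ m) : IsLocallyConstant Φ := by
  obtain ⟨V', hV'V, hV'o, h1⟩ := mem_nhds_iff.1 hV
  refine (IsLocallyConstant.iff_exists_open Φ).2 fun m => ?_
  refine ⟨(fun m' => m' * m⁻¹) ⁻¹' V', hV'o.preimage (continuous_id.mul continuous_const),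
    by simpa only [Set.mem_preimage, mul_inv_cancel] using h1, fun m' hm' => ?_⟩
  have e : m' * m⁻¹ * m = m' := by group
  rw [← e]
  exact h _ (hV'V hm') m

omit [TopologicalSpace G] [IsTopologicalGroup G] in
/-- **The averaging step**: if `φ` is invariant under LEFT multiplication by `W` and `k m₀ k⁻¹ ∈ W` for
every `k ∈ C`, then for any «kernel» `q ↦ (k_q, u_q)` with `k_q ∈ C`,
`∫ φ(k_q (m₀ m u_q) k_q⁻¹) dρ(q) = ∫ φ(k_q (m u_q) k_q⁻¹) dρ(q)` — since
`k (m₀ m u) k⁻¹ = (k m₀ k⁻¹) · (k (m u) k⁻¹)`. [cite: CartierCorvallis1979, §IV.1] -/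
theorem integral_conj_mul_left_eq_of_forall {Y : Type*} [NormedAddCommGroup Y] [NormedSpace ℝ Y]
    {Q : Type*} [MeasurableSpace Q] (ρ : Measure Q) (kf uf : Q → G) {φ : G → Y} {W : Set G}
    (hinv : ∀ w ∈ W, ∀ x, φ (w * x) = φ x) {C : Set G} (hkC : ∀ q, kf q ∈ C) {m₀ : G}
    (hm₀ : ∀ k ∈ C, k * m₀ * k⁻¹ ∈ W) (m : G) :
    ∫ q, φ (kf q * (m₀ * m * uf q) * (kf q)⁻¹) ∂ρ = ∫ q, φ (kf q * (m * uf q) * (kf q)⁻¹) ∂ρ := by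
  refine integral_congr_ae (Eventually.of_forall fun q => ?_)
  have e : kf q * (m₀ * m * uf q) * (kf q)⁻¹ =
      (kf q * m₀ * (kf q)⁻¹) * (kf q * (m * uf q) * (kf q)⁻¹) := by group
  change φ (kf q * (m₀ * m * uf q) * (kf q)⁻¹) = φ (kf q * (m * uf q) * (kf q)⁻¹)
  rw [e, hinv _ (hm₀ _ (hkC q))]

end Generic

/-! ## §2 `GL_n(F)`: the constant term along `P_c` -/

section GeneralLinear

variable (F : Type*) [Field F] [ValuativeRel F] [TopologicalSpace F] [IsNonarchimedeanLocalField F]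
  {n : ℕ} {α : Type*} [LinearOrder α] (c : Fin n → α)

/-! ### §2.1 The `K × U_c` integrand at a fixed `m` -/

omit [ValuativeRel F] [IsNonarchimedeanLocalField F] in
/-- The integrand `q = (k, u) ↦ φ(k (m u) k⁻¹)` of the constant term is continuous on `K × U_c` for
continuous `φ` (`K` any subgroup). [cite: Rogawski1990, §4.13 Lemma 4.13.1 (a) p. 64] -/
theorem continuous_constantTermIntegrand [IsTopologicalRing F] (K : Subgroup (GL (Fin n) F))
    {Y : Type*} [TopologicalSpace Y] {φ : GL (Fin n) F → Y} (hφ : Continuous φ) (m : GL (Fin n) F) :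
    Continuous fun q : ↥K × ↥(unipotentRadicalGL F c) =>
      φ ((q.1 : GL (Fin n) F) * (m * (q.2 : GL (Fin n) F)) * (q.1 : GL (Fin n) F)⁻¹) :=
  hφ.comp (((continuous_subtype_val.comp continuous_fst).mul
    (continuous_const.mul (continuous_subtype_val.comp continuous_snd))).mul
    (continuous_subtype_val.comp continuous_fst).inv)

omit [ValuativeRel F] [IsNonarchimedeanLocalField F] in
/-- **Support bookkeeping**: if `φ(k x k⁻¹) ≠ 0` with `k` in a set `C`, then `x` lies in the image
`C⁻¹ · tsupport φ · C` of `C × tsupport φ` under `(k, s) ↦ k⁻¹ s k`. [cite: Rogawski1990, §4.13 Lemma 4.13.1 (a) p. 64] -/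
theorem mem_image_of_apply_conj_ne_zero [IsTopologicalRing F] {Y : Type*} [Zero Y] [TopologicalSpace Y]
    {φ : GL (Fin n) F → Y} {C : Set (GL (Fin n) F)} {k x : GL (Fin n) F} (hk : k ∈ C)
    (hx : φ (k * x * k⁻¹) ≠ 0) :
    x ∈ (fun p : GL (Fin n) F × GL (Fin n) F => p.1⁻¹ * p.2 * p.1) '' (C ×ˢ tsupport φ) := by
  refine ⟨(k, k * x * k⁻¹), Set.mk_mem_prod hk (subset_tsupport φ hx), ?_⟩
  change k⁻¹ * (k * x * k⁻¹) * k = x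
  group

omit [ValuativeRel F] [IsNonarchimedeanLocalField F] in
/-- `C⁻¹ · tsupport φ · C` is compact for `C` compact and `φ` compactly supported. [cite: CartierCorvallis1979, §IV.1] -/
theorem isCompact_image_conj_tsupport [IsTopologicalRing F] {Y : Type*} [Zero Y] [TopologicalSpace Y]
    {φ : GL (Fin n) F → Y} (hφ : HasCompactSupport φ) {C : Set (GL (Fin n) F)} (hC : IsCompact C) :
    IsCompact ((fun p : GL (Fin n) F × GL (Fin n) F => p.1⁻¹ * p.2 * p.1) '' (C ×ˢ tsupport φ)) :=
  (hC.prod hφ.isCompact).image ((continuous_fst.inv.mul continuous_snd).mul continuous_fst)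

/-- **The `K × U_c` integrand at a fixed `m` has compact support** for `φ` compactly supported:
`φ(k (m u) k⁻¹) ≠ 0` forces `m u ∈ K⁻¹ (tsupport φ) K`, a compact set, and `U_c` is closed.
[cite: Rogawski1990, §4.13 Lemma 4.13.1 (a) pp. 64–66] -/
theorem hasCompactSupport_constantTermIntegrand {Y : Type*} [Zero Y] [TopologicalSpace Y]
    {φ : GL (Fin n) F → Y} (hφ : HasCompactSupport φ) (m : GL (Fin n) F) :
    HasCompactSupport fun q : ↥(glInt n F) × ↥(unipotentRadicalGL F c) =>
      φ ((q.1 : GL (Fin n) F) * (m * (q.2 : GL (Fin n) F)) * (q.1 : GL (Fin n) F)⁻¹) := by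
  haveI : T2Space F := (isLocalField F).toT2Space
  haveI : CompactSpace ↥(glInt n F) := isCompact_iff_compactSpace.1 (isCompact_glInt n F)
  set S' := (fun p : GL (Fin n) F × GL (Fin n) F => p.1⁻¹ * p.2 * p.1) ''
    ((glInt n F : Set (GL (Fin n) F)) ×ˢ tsupport φ) with hS'
  have hS'c : IsCompact S' := isCompact_image_conj_tsupport F hφ (isCompact_glInt n F)
  set D : Set ↥(unipotentRadicalGL F c) := Subtype.val ⁻¹' ((fun x : GL (Fin n) F => m⁻¹ * x) '' S') with hD
  have hDc : IsCompact D :=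
    (isClosed_unipotentRadicalGL (R := F) c).isClosedEmbedding_subtypeVal.isCompact_preimage
      (hS'c.image (continuous_const.mul continuous_id))
  refine HasCompactSupport.intro (isCompact_univ.prod hDc) fun q hq => ?_
  by_contra hne
  refine hq (Set.mk_mem_prod (Set.mem_univ _) ?_)
  refine ⟨m * (q.2 : GL (Fin n) F),
    mem_image_of_apply_conj_ne_zero F (C := (glInt n F : Set (GL (Fin n) F))) q.1.2 hne, ?_⟩
  change m⁻¹ * (m * (q.2 : GL (Fin n) F)) = (q.2 : GL (Fin n) F)
  rw [inv_mul_cancel_left]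

/-- **The `K × U_c` integrand at a fixed `m` is integrable** for `φ` continuous with compact support and
`κ`, `μ_U` finite on compacta. [cite: Rogawski1990, §4.13 Lemma 4.13.1 (a) pp. 64–66] -/
theorem integrable_constantTermIntegrand [MeasurableSpace (GL (Fin n) F)] [BorelSpace (GL (Fin n) F)]
    {Y : Type*} [NormedAddCommGroup Y] {φ : GL (Fin n) F → Y} (hφc : Continuous φ)
    (hφ : HasCompactSupport φ) (κ : Measure ↥(glInt n F)) [IsFiniteMeasureOnCompacts κ]
    (μU : Measure ↥(unipotentRadicalGL F c)) [IsFiniteMeasureOnCompacts μU] (m : GL (Fin n) F) :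
    Integrable (fun q : ↥(glInt n F) × ↥(unipotentRadicalGL F c) =>
      φ ((q.1 : GL (Fin n) F) * (m * (q.2 : GL (Fin n) F)) * (q.1 : GL (Fin n) F)⁻¹)) (κ.prod μU) := by
  haveI : T2Space F := (isLocalField F).toT2Space
  haveI : SecondCountableTopology F := secondCountableTopology_localField F
  haveI : SecondCountableTopology (Matrix (Fin n) (Fin n) F) := inferInstanceAs (SecondCountableTopology (Fin n → Fin n → F))
  haveI : SecondCountableTopology (Matrix (Fin n) (Fin n) F)ᵐᵒᵖ := MulOpposite.opHomeomorph.symm.secondCountableTopology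
  haveI : SecondCountableTopology (GL (Fin n) F) := Units.isEmbedding_embedProduct.secondCountableTopology
  haveI : SecondCountableTopology ↥(glInt n F) := TopologicalSpace.Subtype.secondCountableTopology _
  haveI : SecondCountableTopology ↥(unipotentRadicalGL F c) := TopologicalSpace.Subtype.secondCountableTopology _
  haveI : BorelSpace ↥(unipotentRadicalGL F c) := Subtype.borelSpace _
  haveI : BorelSpace ↥(glInt n F) := Subtype.borelSpace _
  haveI : BorelSpace (↥(glInt n F) × ↥(unipotentRadicalGL F c)) := Prod.borelSpace
  exact (continuous_constantTermIntegrand F c (glInt n F) hφc m).integrable_of_hasCompactSupport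
    (hasCompactSupport_constantTermIntegrand F c hφ m)

/-! ### §2.2 Local constancy of `m ↦ φ^{(P)}(m)` on `GL_n(F)` -/

/-- **The constant term of a function invariant under left translation by a neighbourhood `W` of `1` is
locally constant on `GL_n(F)`** (ANY measure `ρ` on `K × U_c`): by §1 there is an open `V ∋ 1` with
`k V k⁻¹ ⊆ W` for all `k ∈ K = GL_n(𝒪)`, so `φ^{(P)}(m₀ m) = ∫ φ((k m₀ k⁻¹)(k (m u) k⁻¹)) = φ^{(P)}(m)` for
`m₀ ∈ V`. [cite: CartierCorvallis1979, §IV.1–IV.2] [cite: BernsteinZelevinsky1977, §2.3] -/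
theorem isLocallyConstant_constantTerm_of_forall_mul_left
    [MeasurableSpace (↥(glInt n F) × ↥(unipotentRadicalGL F c))]
    (ρ : Measure (↥(glInt n F) × ↥(unipotentRadicalGL F c)))
    {Y : Type*} [NormedAddCommGroup Y] [NormedSpace ℝ Y] {φ : GL (Fin n) F → Y}
    {W : Set (GL (Fin n) F)} (hW : W ∈ 𝓝 (1 : GL (Fin n) F)) (hinv : ∀ w ∈ W, ∀ x, φ (w * x) = φ x) :
    IsLocallyConstant fun m : GL (Fin n) F =>
      ∫ q, φ ((q.1 : GL (Fin n) F) * (m * (q.2 : GL (Fin n) F)) * (q.1 : GL (Fin n) F)⁻¹) ∂ρ := by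
  obtain ⟨W', hW'W, hW'o, h1⟩ := mem_nhds_iff.1 hW
  obtain ⟨V, hVo, h1V, hV⟩ :=
    exists_open_nhds_one_forall_conj_mem (isCompact_glInt n F) hW'o h1
  refine isLocallyConstant_of_forall_nhds_one_mul (hVo.mem_nhds h1V) fun m₀ hm₀ m => ?_
  exact integral_conj_mul_left_eq_of_forall ρ
    (fun q : ↥(glInt n F) × ↥(unipotentRadicalGL F c) => (q.1 : GL (Fin n) F))
    (fun q => (q.2 : GL (Fin n) F)) (fun w hw x => hinv w (hW'W hw) x) (fun q => q.1.2)
    (fun k hk => hV k hk m₀ hm₀) m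

/-- **The constant term of a locally constant compactly supported `φ` is locally constant on `GL_n(F)`**
(any `ρ`): `φ` is left-invariant under a compact open subgroup `K₀` (★
`exists_isOpen_isCompact_forall_mul_eq_of_isLocallyConstant`, ★ `nonarchimedeanGroup_gl`), so the previous
theorem applies with `W = K₀`. [cite: BernsteinZelevinsky1977, §2.3] [cite: CartierCorvallis1979, §IV.1–IV.2] -/
theorem isLocallyConstant_constantTerm [MeasurableSpace (↥(glInt n F) × ↥(unipotentRadicalGL F c))]
    (ρ : Measure (↥(glInt n F) × ↥(unipotentRadicalGL F c))) {φ : GL (Fin n) F → ℂ}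
    (hlc : IsLocallyConstant φ) (hcs : HasCompactSupport φ) :
    IsLocallyConstant fun m : GL (Fin n) F =>
      ∫ q, φ ((q.1 : GL (Fin n) F) * (m * (q.2 : GL (Fin n) F)) * (q.1 : GL (Fin n) F)⁻¹) ∂ρ := by
  haveI : T2Space F := (isLocalField F).toT2Space
  haveI : LocallyCompactSpace F := (isLocalField F).toLocallyCompactSpace
  haveI : LocallyCompactSpace (Matrix (Fin n) (Fin n) F) := inferInstanceAs (LocallyCompactSpace (Fin n → Fin n → F))
  haveI : LocallyCompactSpace (GL (Fin n) F) := inferInstance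
  haveI : NonarchimedeanGroup (GL (Fin n) F) := nonarchimedeanGroup_gl F n
  obtain ⟨K₀, hK₀o, -, hK₀⟩ := exists_isOpen_isCompact_forall_mul_eq_of_isLocallyConstant hlc hcs
  exact isLocallyConstant_constantTerm_of_forall_mul_left F c ρ (hK₀o.mem_nhds K₀.one_mem)
    fun w hw x => (hK₀ x w hw).2

/-! ### §2.3 On the Levi `M_c`: local constancy and compact support of `φ^{(P)}|_{M_c}` -/

variable [Fintype α]

/-- The constant term of `φ ∈ C_c^∞(GL_n(F))` RESTRICTED TO THE LEVI `M_c` is locally constant.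
[cite: BernsteinZelevinsky1977, §2.3] -/
theorem isLocallyConstant_constantTerm_levi
    [MeasurableSpace (↥(glInt n F) × ↥(unipotentRadicalGL F c))]
    (ρ : Measure (↥(glInt n F) × ↥(unipotentRadicalGL F c))) {φ : GL (Fin n) F → ℂ}
    (hlc : IsLocallyConstant φ) (hcs : HasCompactSupport φ) :
    IsLocallyConstant fun m : ↥(standardLeviGL F c) =>
      ∫ q, φ ((q.1 : GL (Fin n) F) * ((m : GL (Fin n) F) * (q.2 : GL (Fin n) F)) *
        (q.1 : GL (Fin n) F)⁻¹) ∂ρ :=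
  (isLocallyConstant_constantTerm F c ρ hlc hcs).comp_continuous continuous_subtype_val


omit [ValuativeRel F] [TopologicalSpace F] [IsNonarchimedeanLocalField F] in
/-- **The block-diagonal part of `m u` is `m`**: for `m ∈ M_c` and `u ∈ U_c`,
`blockDiagonalGL (leviProjection (m u)) = m` (★ `leviProjection` is a homomorphism killing `U_c`, and
`leviProjection ∘ leviEmbeddingP = id`). [cite: BernsteinZelevinsky1977, §2.1] -/
theorem blockDiagonalGL_leviProjection_levi_mul_unipotent {m u : GL (Fin n) F}
    (hm : m ∈ standardLeviGL F c) (hu : u ∈ unipotentRadicalGL F c)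
    (hmu : m * u ∈ standardParabolicGL F c) :
    blockDiagonalGL F c (leviProjection F c ⟨m * u, hmu⟩) = m := by
  obtain ⟨x, rfl⟩ := hm
  obtain ⟨p, hp, rfl⟩ := hu
  have e : (⟨leviEmbedding F c x * (standardParabolicGL F c).subtype p, hmu⟩ :
      ↥(standardParabolicGL F c)) = leviEmbeddingP F c x * p := Subtype.ext rfl
  rw [e, map_mul, leviProjection_leviEmbeddingP_apply, MonoidHom.mem_ker.1 hp, mul_one,
    leviEmbedding_apply]

omit [ValuativeRel F] [TopologicalSpace F] [IsNonarchimedeanLocalField F] in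
/-- `diag(x_a)_a ∈ M_c` (the range of ★ `leviEmbedding`, ★ `leviEmbedding_apply`). [cite: BernsteinZelevinsky1977, §2.1] -/
theorem blockDiagonalGL_mem_standardLeviGL (x : Π a, GL {i // c i = a} F) :
    blockDiagonalGL F c x ∈ standardLeviGL F c :=
  show blockDiagonalGL F c x ∈ (leviEmbedding F c).range from ⟨x, leviEmbedding_apply c x⟩

/-- **The constant term of a compactly supported `φ` has compact support on `M_c`** (any `ρ`): if
`φ^{(P)}(m) ≠ 0` then `φ(k (m u) k⁻¹) ≠ 0` for some `(k, u)`, so `m u ∈ P_c ∩ K⁻¹ (tsupport φ) K` — compact, `P_c`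
being closed — and `m` is its block-diagonal part: `supp φ^{(P)}|_{M_c}` lies in the continuous image of a compact
set under `blockDiagonalGL ∘ leviProjection` (★ `continuous_blockDiagonalGL`, ★ `continuous_leviProjection`).
[cite: BernsteinZelevinsky1977, §2.3] [cite: Rogawski1990, §4.13 Lemma 4.13.1 (a) pp. 64–66] -/
theorem hasCompactSupport_constantTerm_levi
    [MeasurableSpace (↥(glInt n F) × ↥(unipotentRadicalGL F c))]
    (ρ : Measure (↥(glInt n F) × ↥(unipotentRadicalGL F c)))
    {Y : Type*} [NormedAddCommGroup Y] [NormedSpace ℝ Y] {φ : GL (Fin n) F → Y}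
    (hφ : HasCompactSupport φ) :
    HasCompactSupport fun m : ↥(standardLeviGL F c) =>
      ∫ q, φ ((q.1 : GL (Fin n) F) * ((m : GL (Fin n) F) * (q.2 : GL (Fin n) F)) *
        (q.1 : GL (Fin n) F)⁻¹) ∂ρ := by
  haveI : T2Space F := (isLocalField F).toT2Space
  set S' := (fun p : GL (Fin n) F × GL (Fin n) F => p.1⁻¹ * p.2 * p.1) ''
    ((glInt n F : Set (GL (Fin n) F)) ×ˢ tsupport φ) with hS'
  have hS'c : IsCompact S' := isCompact_image_conj_tsupport F hφ (isCompact_glInt n F)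
  -- the compact set of elements of `P_c` lying in `S'`, and the image of its block-diagonal parts in `M_c`
  set T : Set ↥(standardParabolicGL F c) := Subtype.val ⁻¹' S' with hT
  have hTc : IsCompact T :=
    (isClosed_standardParabolicGL F c).isClosedEmbedding_subtypeVal.isCompact_preimage hS'c
  set bd : ↥(standardParabolicGL F c) → ↥(standardLeviGL F c) := fun p =>
    ⟨blockDiagonalGL F c (leviProjection F c p), blockDiagonalGL_mem_standardLeviGL F c _⟩ with hbd
  have hbdc : Continuous bd :=
    ((continuous_blockDiagonalGL F c).comp (continuous_leviProjection F c)).subtype_mk _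
  refine HasCompactSupport.intro (hTc.image hbdc) fun m hm => ?_
  -- off the image every value of the integrand vanishes
  have hzero : ∀ q : ↥(glInt n F) × ↥(unipotentRadicalGL F c),
      φ ((q.1 : GL (Fin n) F) * ((m : GL (Fin n) F) * (q.2 : GL (Fin n) F)) * (q.1 : GL (Fin n) F)⁻¹) =
        0 := by
    intro q
    by_contra hne
    refine hm ⟨⟨(m : GL (Fin n) F) * (q.2 : GL (Fin n) F), mul_mem (standardLeviGL_le F c m.2)
      (unipotentRadicalGL_le F c q.2.2)⟩, ?_, ?_⟩
    · exact mem_image_of_apply_conj_ne_zero F (C := (glInt n F : Set (GL (Fin n) F))) q.1.2 hne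
    · exact Subtype.ext (blockDiagonalGL_leviProjection_levi_mul_unipotent F c m.2 q.2.2 _)
  simp only [hzero, integral_zero]

/-- **`φ ∈ C_c^∞(GL_n(F)) ⇒ φ^{(P)}|_{M_c} ∈ C_c^∞(M_c)`, with a locally constant multiplier**: for
`ψ : M_c → ℂ` locally constant (the slot for `τ_v · δ_P^{1/2}` of the transfer, or `1`), the function
`m ↦ ψ(m) · φ^{(P)}(m)` on `M_c` is locally constant with compact support.
[cite: Rogawski1990, §4.13 Lemma 4.13.1 (a) p. 64; §4.9 Prop. 4.9.1 (a) p. 55] [cite: BernsteinZelevinsky1977, §2.3] -/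
theorem isLocallyConstant_and_hasCompactSupport_mul_constantTerm_levi
    [MeasurableSpace (↥(glInt n F) × ↥(unipotentRadicalGL F c))]
    (ρ : Measure (↥(glInt n F) × ↥(unipotentRadicalGL F c))) {φ : GL (Fin n) F → ℂ}
    (hlc : IsLocallyConstant φ) (hcs : HasCompactSupport φ) {ψ : ↥(standardLeviGL F c) → ℂ}
    (hψ : IsLocallyConstant ψ) :
    IsLocallyConstant (fun m : ↥(standardLeviGL F c) => ψ m *
        ∫ q, φ ((q.1 : GL (Fin n) F) * ((m : GL (Fin n) F) * (q.2 : GL (Fin n) F)) *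
          (q.1 : GL (Fin n) F)⁻¹) ∂ρ) ∧
      HasCompactSupport (fun m : ↥(standardLeviGL F c) => ψ m *
        ∫ q, φ ((q.1 : GL (Fin n) F) * ((m : GL (Fin n) F) * (q.2 : GL (Fin n) F)) *
          (q.1 : GL (Fin n) F)⁻¹) ∂ρ) :=
  ⟨hψ.mul (isLocallyConstant_constantTerm_levi F c ρ hlc hcs),
    (hasCompactSupport_constantTerm_levi F c ρ hcs).mul_left⟩

/-! ### §2.4 The same on the block coordinates `Π_a GL_{n_a}(F)` -/

omit [ValuativeRel F] [IsNonarchimedeanLocalField F] in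
/-- **`x ↦ diag(x_a)_a : Π_a GL_{n_a}(F) → M_c` is a closed embedding** — indeed a homeomorphism onto
`M_c` (continuous ★ `continuous_blockDiagonalGL`, with continuous inverse `m ↦ leviProjection m` ★
`continuous_leviProjection`). [cite: BernsteinZelevinsky1977, §2.1] -/
theorem isClosedEmbedding_blockDiagonalGL_codRestrict [IsTopologicalRing F] :
    IsClosedEmbedding fun x : Π a, GL {i // c i = a} F =>
      (⟨blockDiagonalGL F c x, blockDiagonalGL_mem_standardLeviGL F c x⟩ : ↥(standardLeviGL F c)) := by
  let e : (Π a, GL {i // c i = a} F) ≃ₜ ↥(standardLeviGL F c) :=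
    { toFun := fun x => ⟨blockDiagonalGL F c x, blockDiagonalGL_mem_standardLeviGL F c x⟩
      invFun := fun m => leviProjection F c ⟨(m : GL (Fin n) F), standardLeviGL_le F c m.2⟩
      left_inv := fun x => by
        have e1 : (⟨blockDiagonalGL F c x, standardLeviGL_le F c (blockDiagonalGL_mem_standardLeviGL F c x)⟩ :
            ↥(standardParabolicGL F c)) = leviEmbeddingP F c x := Subtype.ext rfl
        change leviProjection F c ⟨blockDiagonalGL F c x, _⟩ = x
        rw [e1, leviProjection_leviEmbeddingP_apply]
      right_inv := fun m => by
        obtain ⟨m, x, rfl⟩ := m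
        apply Subtype.ext
        have e1 : (⟨leviEmbedding F c x, standardLeviGL_le F c ⟨x, rfl⟩⟩ : ↥(standardParabolicGL F c)) =
            leviEmbeddingP F c x := Subtype.ext rfl
        change blockDiagonalGL F c (leviProjection F c ⟨leviEmbedding F c x, _⟩) = leviEmbedding F c x
        rw [e1, leviProjection_leviEmbeddingP_apply, leviEmbedding_apply]
      continuous_toFun := (continuous_blockDiagonalGL F c).subtype_mk _
      continuous_invFun := (continuous_leviProjection F c).comp
        (continuous_subtype_val.subtype_mk _) }
  exact e.isClosedEmbedding

/-- The constant term of a compactly supported `φ`, read on the block coordinates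
`x ↦ φ^{(P)}(diag(x_a)_a)`, has compact support on `Π_a GL_{n_a}(F)`. [cite: BernsteinZelevinsky1977, §2.3] -/
theorem hasCompactSupport_constantTerm_blockDiagonalGL
    [MeasurableSpace (↥(glInt n F) × ↥(unipotentRadicalGL F c))]
    (ρ : Measure (↥(glInt n F) × ↥(unipotentRadicalGL F c)))
    {Y : Type*} [NormedAddCommGroup Y] [NormedSpace ℝ Y] {φ : GL (Fin n) F → Y}
    (hφ : HasCompactSupport φ) :
    HasCompactSupport fun x : Π a, GL {i // c i = a} F =>
      ∫ q, φ ((q.1 : GL (Fin n) F) * (blockDiagonalGL F c x * (q.2 : GL (Fin n) F)) *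
        (q.1 : GL (Fin n) F)⁻¹) ∂ρ := by
  have h := (hasCompactSupport_constantTerm_levi F c ρ hφ).comp_isClosedEmbedding
    (isClosedEmbedding_blockDiagonalGL_codRestrict F c)
  exact h

/-- The constant term of a locally constant compactly supported `φ`, read on the block coordinates, is
locally constant on `Π_a GL_{n_a}(F)`. [cite: BernsteinZelevinsky1977, §2.3] -/
theorem isLocallyConstant_constantTerm_blockDiagonalGL
    [MeasurableSpace (↥(glInt n F) × ↥(unipotentRadicalGL F c))]
    (ρ : Measure (↥(glInt n F) × ↥(unipotentRadicalGL F c))) {φ : GL (Fin n) F → ℂ}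
    (hlc : IsLocallyConstant φ) (hcs : HasCompactSupport φ) :
    IsLocallyConstant fun x : Π a, GL {i // c i = a} F =>
      ∫ q, φ ((q.1 : GL (Fin n) F) * (blockDiagonalGL F c x * (q.2 : GL (Fin n) F)) *
        (q.1 : GL (Fin n) F)⁻¹) ∂ρ :=
  haveI : T2Space F := (isLocalField F).toT2Space
  (isLocallyConstant_constantTerm F c ρ hlc hcs).comp_continuous (continuous_blockDiagonalGL F c)

end GeneralLinear

end Literature.NumberTheory.Automorphic

end
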